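import Summits.CriticalPhenomena.PercolationContinuityZ3.Theorems.PercNearOneGluingNoHeavyLowerTailQuantitativeGenZeroSet
import Summits.CriticalPhenomena.PercolationContinuityZ3.Theorems.PercNearOneGluingNoHeavyLowerTailQuantitativeS5ZeroSetGeneral
import Summits.CriticalPhenomena.PercolationContinuityZ3.Theorems.PercNearOneGluingNoHeavyLowerTailQuantitativeBHKPositiveExact
import HarnessLib

/-!
# The EQUALITY LOCUS of the localised union bound (AG-loc): a decidable support-graph condition

Support file (`--supports stmt-CriticalPhenomena-4575`), prover seat `prim-rate-mine-2` (lane prim-rate, constants-miner (c), BENCH row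
M2-R43 (v); `run/shared/lean/prim/prim-rate/prim-rate-mine-2/PROOFS.md` §P44 (v)).  No definitions, no named facts, no sorries; standard axioms.

(AG-loc) (`AGloc.additiveGluing_of_agloc_firstRank`'s hypothesis; Kozma–Nitzan's Question 5 shape): for an injective rank on `A` with less reliable relays first and the
first-in-rank patterns `P_a = {o ↔ a} ∩ ⋂_{r a' < r a} {o ↮ a'}`,  `μ(o ↔ A, o ↮ b) ≤ Σ_{a ∈ A} μ(P_a)·μ(a ↮ b)`.  It is (GEN) at `F = 1{b ∈ ·}`:
* `CSH.surplus_connFun_eq_agloc_slack` — `surplus w A r 1{b ∈ ·} o = Σ_a μ(P_a)·μ(a ↮ b) − μ(o ↔ A, o ↮ b)` (any weights, any rank);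
* `CSH.agloc_eq_iff` — **THE EQUALITY LOCUS** (weights `0` off a preconnected... no: ANY support `E`, in `(0,1)` on `E`; `r` injective and reliability-compatible on `A`, top relay `k`,
  `T = A ∖ k`; `o ∉ A`; `b ∉ A`):  `μ(o ↔ A, o ↮ b) = Σ_a μ(P_a)·μ(a ↮ b)` iff
  (Z) the (S5) margin of `(T; o, k)` at `1{b ∈ ·}` vanishes — row M2-R29's four geometries `¬(o ⇝ b) ∨ (no relay of T reachable from o) ∨ (M1)_{o,k} ∨ (M2)_o` —, AND
  (R) `μ(k ↮ T, o ↔ k) = 0` or the top relay's rank gain vanishes, AND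
  (H) NOT [`b ⇝ o` in `(V, E_T) − k` and `k` has an `E`-neighbour in that component] — row M2-R16's criterion (vdBHK Thm 1.3 is an equality).
  Assembly of `CSH.surplus_eq_zero_iff_three` (GEN peeling identity) with `CSH.s5dMargin_nil_eq_zero_iff_general` and `QuantBHK.condCov_openConn_pos_iff`.
[cite: KozmaNitzan2024, Question 5 and Conj. 4 (p. 32)] [cite: VandenbergHaggstromKahn2005, Thm. 1.3 (p. 6)] [cite: Harris1960, Lemma 4.1 (p. 16)]
-/

noncomputable section

namespace Summit.CriticalPhenomena.PercolationContinuityZ3.Theorems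

open MeasureTheory Set Literature.Probability.LatticeModels Literature.Probability.Percolation
open scoped Classical
open KNPreFKG

namespace CSH

variable {n : ℕ}

/-- **(GEN) at a connection functional is the slack of (AG-loc)**: for any weights and any rank injective on `A`,
`surplus w A r 1{b ∈ ·} o = Σ_{a ∈ A} μ(P_a)·μ(a ↮ b) − μ(o ↔ A, o ↮ b)` (the patterns `P_a` partition `{o ↔ A}`).
[cite: KozmaNitzan2024, Question 5 (p. 32)] -/
theorem surplus_connFun_eq_agloc_slack (w : Sym2 (Fin n) → unitInterval) (A : Finset (Fin n)) (r : Fin n → ℕ) (hr : Set.InjOn r ↑A)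
    (o b : Fin n) :
    surplus w A r (fun S : Set (Fin n) => if b ∈ S then (1 : ℝ) else 0) o =
      (∑ a ∈ A, (prodBernoulli w).real
          (openConn o a ∩ ⋂ a' ∈ A.filter (fun a' => r a' < r a), (openConn o a')ᶜ : Set (BondConfig (Fin n))) *
        (prodBernoulli w).real (openConn a b : Set (BondConfig (Fin n)))ᶜ) -
      (prodBernoulli w).real ((⋃ a ∈ A, openConn o a) ∩ (openConn o b : Set (BondConfig (Fin n)))ᶜ) := by
  set μ := prodBernoulli w with hμ
  have hmeas : ∀ S : Set (BondConfig (Fin n)), MeasurableSet S := fun _ => MeasurableSet.of_discrete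
  set U : Set (BondConfig (Fin n)) := ⋃ a ∈ A, openConn o a with hU
  have hind : ∀ c : Fin n, (fun ω : BondConfig (Fin n) => (fun S : Set (Fin n) => if b ∈ S then (1 : ℝ) else 0) (openCluster ω c)) =
      (openConn c b : Set (BondConfig (Fin n))).indicator (fun _ => (1 : ℝ)) := by
    intro c; funext ω
    by_cases h : ω ∈ (openConn c b : Set (BondConfig (Fin n)))
    · rw [indicator_of_mem h]; exact if_pos h
    · rw [indicator_of_notMem h]; exact if_neg h
  have hI1 : ∫ ω in U, (fun S : Set (Fin n) => if b ∈ S then (1 : ℝ) else 0) (openCluster ω o) ∂μ = μ.real (U ∩ openConn o b) := by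
    rw [show (fun ω => (fun S : Set (Fin n) => if b ∈ S then (1 : ℝ) else 0) (openCluster ω o)) =
      (openConn o b : Set (BondConfig (Fin n))).indicator (fun _ => (1 : ℝ)) from hind o,
      setIntegral_indicator (hmeas _), setIntegral_const, smul_eq_mul, mul_one]
  have hI2 : ∀ a : Fin n, ∫ ω, (fun S : Set (Fin n) => if b ∈ S then (1 : ℝ) else 0) (openCluster ω a) ∂μ = μ.real (openConn a b) := by
    intro a
    rw [show (fun ω => (fun S : Set (Fin n) => if b ∈ S then (1 : ℝ) else 0) (openCluster ω a)) =
      (openConn a b : Set (BondConfig (Fin n))).indicator (fun _ => (1 : ℝ)) from hind a,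
      integral_indicator (hmeas _), setIntegral_const, smul_eq_mul, mul_one]
  have hcompl : ∀ a : Fin n, μ.real (openConn a b : Set (BondConfig (Fin n)))ᶜ = 1 - μ.real (openConn a b) := by
    intro a
    rw [measureReal_compl (hmeas _), probReal_univ]
  have hsplit : μ.real U = μ.real (U ∩ openConn o b) + μ.real (U ∩ (openConn o b : Set (BondConfig (Fin n)))ᶜ) := by
    have h := measureReal_inter_add_sdiff (μ := μ) (s := U) (h := measure_ne_top _ _) (hmeas (openConn o b))
    have hdc : U \ (openConn o b : Set (BondConfig (Fin n))) = U ∩ (openConn o b : Set (BondConfig (Fin n)))ᶜ := by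
      ext ω; exact Iff.rfl
    rw [hdc] at h
    exact h.symm
  have hsum := AGloc.sum_measureReal_firstRank w A r o hr
  unfold surplus
  simp only [← hμ, ← hU] at hsum ⊢
  rw [hI1]
  simp only [hI2, hcompl]
  have : ∑ a ∈ A, μ.real (openConn o a ∩ ⋂ a' ∈ A.filter (fun a' => r a' < r a), (openConn o a')ᶜ) * (1 - μ.real (openConn a b)) =
      μ.real U - ∑ a ∈ A, μ.real (openConn o a ∩ ⋂ a' ∈ A.filter (fun a' => r a' < r a), (openConn o a')ᶜ) * μ.real (openConn a b) := by
    rw [← hsum, ← Finset.sum_sub_distrib]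
    exact Finset.sum_congr rfl fun a _ => by ring
  rw [this, hsplit]
  ring

/-- **THE EQUALITY LOCUS OF (AG-loc).**  Weights `0` off `E`, in `(0,1)` on `E`; `A` with a rank `r` injective on `A` and compatible with the
reliabilities `μ(a ↔ b)`; `k` its top relay, `T = A ∖ k`; `o ∉ A`, `b ∉ A`.  Then the localised union bound is an equality,
`μ(o ↔ A, o ↮ b) = Σ_a μ(P_a)·μ(a ↮ b)`, iff (Z) ∧ (R) ∧ (H) of the file header — a decidable condition on the support graph (and, through the rank
gains, on the reliabilities). [cite: KozmaNitzan2024, Question 5 and Conj. 4 (p. 32)] [cite: VandenbergHaggstromKahn2005, Thm. 1.3 (p. 6)] -/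
theorem agloc_eq_iff (w : Sym2 (Fin n) → unitInterval) (E : Set (Sym2 (Fin n)))
    (hE0 : ∀ f, f ∉ E → (w f : ℝ) = 0) (hE1 : ∀ f ∈ E, 0 < (w f : ℝ) ∧ (w f : ℝ) < 1)
    (A : Finset (Fin n)) (r : Fin n → ℕ) (hr : Set.InjOn r ↑A) (k : Fin n) (hkA : k ∈ A) (hkmax : ∀ a ∈ A, r a ≤ r k)
    (o b : Fin n) (hoA : o ∉ A) (hbA : b ∉ A)
    (hcompat : ∀ a ∈ A, ∀ a' ∈ A, r a < r a' →
      ∫ ω, (fun S : Set (Fin n) => if b ∈ S then (1 : ℝ) else 0) (openCluster ω a) ∂(prodBernoulli w) ≤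
        ∫ ω, (fun S : Set (Fin n) => if b ∈ S then (1 : ℝ) else 0) (openCluster ω a') ∂(prodBernoulli w)) :
    (prodBernoulli w).real ((⋃ a ∈ A, openConn o a) ∩ (openConn o b : Set (BondConfig (Fin n)))ᶜ) =
        ∑ a ∈ A, (prodBernoulli w).real
            (openConn o a ∩ ⋂ a' ∈ A.filter (fun a' => r a' < r a), (openConn o a')ᶜ : Set (BondConfig (Fin n))) *
          (prodBernoulli w).real (openConn a b : Set (BondConfig (Fin n)))ᶜ ↔
      ((¬ (openGraph E).Reachable o b) ∨ (∀ t ∈ A.erase k, ¬ (openGraph E).Reachable o t) ∨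
        ((∀ p q : Fin n, s(p, q) ∈ E →
            (openGraph {f | f ∈ E ∧ ∀ z ∈ f, z ∉ A.erase k ∧ z ≠ k}).Reachable o p →
              (openGraph {f | f ∈ E ∧ ∀ z ∈ f, z ∉ A.erase k ∧ z ≠ k}).Reachable o q ∨ q = k) ∧
          ¬ (openGraph {f | f ∈ E ∧ ∀ z ∈ f, z ∉ A.erase k ∧ z ≠ k}).Reachable o b) ∨
        (∃ a ∈ A.erase k, (∀ p q : Fin n, s(p, q) ∈ E →
            (openGraph {f | f ∈ E ∧ ∀ z ∈ f, z ∉ A.erase k}).Reachable o p →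
              (openGraph {f | f ∈ E ∧ ∀ z ∈ f, z ∉ A.erase k}).Reachable o q ∨ q = a) ∧
          rankGain w (A.erase k) r (fun S : Set (Fin n) => if b ∈ S then (1 : ℝ) else 0) a = 0 ∧
          ¬ (openGraph {f | f ∈ E ∧ ∀ z ∈ f, z ∉ A.erase k}).Reachable o b)) ∧
      ((prodBernoulli w).real ({ω : BondConfig (Fin n) | ∀ a ∈ (↑(A.erase k) : Set (Fin n)), ¬ (openGraph ω).Reachable k a} ∩ openConn o k) = 0 ∨
        rankGain w A r (fun S : Set (Fin n) => if b ∈ S then (1 : ℝ) else 0) k = 0) ∧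
      ¬ ((openGraph {f | f ∈ E ∧ k ∉ f ∧ ∀ x ∈ (↑(A.erase k) : Set (Fin n)), x ∉ f}).Reachable b o ∧
          ∃ u, s(k, u) ∈ E ∧ (openGraph {f | f ∈ E ∧ k ∉ f ∧ ∀ x ∈ (↑(A.erase k) : Set (Fin n)), x ∉ f}).Reachable b u) := by
  set μ := prodBernoulli w with hμ
  set F : Set (Fin n) → ℝ := fun S => if b ∈ S then (1 : ℝ) else 0 with hFdef
  have hF : ∀ S S' : Set (Fin n), S ⊆ S' → F S ≤ F S' := by
    intro S S' h
    simp only [hFdef]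
    by_cases hS : b ∈ S
    · rw [if_pos hS, if_pos (h hS)]
    · rw [if_neg hS]; split_ifs <;> norm_num
  have hF0 : ∀ S : Set (Fin n), 0 ≤ F S := fun S => by simp only [hFdef]; split_ifs <;> norm_num
  set T : Finset (Fin n) := A.erase k with hT
  have hTA : ∀ a ∈ T, a ∈ A := fun a ha => Finset.mem_of_mem_erase ha
  have hkT : k ∉ T := Finset.notMem_erase k A
  have hoT : o ∉ T := fun h => hoA (hTA o h)
  have hbT : b ∉ T := fun h => hbA (hTA b h)
  have hok : o ≠ k := fun h => hoA (h ▸ hkA)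
  have hbk : b ≠ k := fun h => hbA (h ▸ hkA)
  have hrT : Set.InjOn r ↑T := hr.mono (by intro a ha; exact Finset.mem_of_mem_erase ha)
  have hcompatT : ∀ a ∈ T, ∀ a' ∈ T, r a < r a' →
      ∫ ω, F (openCluster ω a) ∂μ ≤ ∫ ω, F (openCluster ω a') ∂μ := fun a ha a' ha' h => hcompat a (hTA a ha) a' (hTA a' ha') h
  have hmeas : ∀ S : Set (BondConfig (Fin n)), MeasurableSet S := fun _ => MeasurableSet.of_discrete
  -- the slack identity: equality iff `surplus = 0`
  have hslack := surplus_connFun_eq_agloc_slack w A r hr o b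
  have hiff3 := surplus_eq_zero_iff_three w E hE0 hE1 A r hr k hkA hkmax o hoA F hF hF0 hcompat
  have hZ := s5dMargin_nil_eq_zero_iff_general w E hE0 hE1 o k b hok T r hrT hcompatT hoT hkT
  -- the third piece: `covD` of the connection functional is M2-R16's difference
  set D : Set (BondConfig (Fin n)) := {ω : BondConfig (Fin n) | ∀ a ∈ (↑T : Set (Fin n)), ¬ (openGraph ω).Reachable k a} with hD
  have hFh : ∀ ω : BondConfig (Fin n), (fun C : Set (Sym2 (Fin n)) => F {a | a = k ∨ ∃ e ∈ C, a ∈ e}) (openEdgeCluster ω k) =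
      (openConn k b : Set (BondConfig (Fin n))).indicator (fun _ => (1 : ℝ)) ω := by
    intro ω
    have h1 : F {a | a = k ∨ ∃ e ∈ openEdgeCluster ω k, a ∈ e} = F (openCluster ω k) := by
      rw [KNPreFKG.openCluster_eq_setOf_openEdgeCluster]
    simp only [h1]
    by_cases h : ω ∈ (openConn k b : Set (BondConfig (Fin n)))
    · rw [indicator_of_mem h]; exact if_pos h
    · rw [indicator_of_notMem h]; exact if_neg h
  have hcov : covD w k (↑T : Set (Fin n)) (fun C : Set (Sym2 (Fin n)) => F {a | a = k ∨ ∃ e ∈ C, a ∈ e}) o =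
      μ.real D * μ.real (D ∩ openConn k b ∩ openConn k o) - μ.real (D ∩ openConn k b) * μ.real (D ∩ openConn k o) := by
    unfold covD
    simp only [← hμ, ← hD]
    rw [show (fun ω => (fun C : Set (Sym2 (Fin n)) => F {a | a = k ∨ ∃ e ∈ C, a ∈ e}) (openEdgeCluster ω k)) =
      (openConn k b : Set (BondConfig (Fin n))).indicator (fun _ => (1 : ℝ)) from funext hFh,
      setIntegral_indicator (hmeas _), setIntegral_indicator (hmeas _), setIntegral_const, setIntegral_const, smul_eq_mul, smul_eq_mul,
      mul_one, mul_one, show D ∩ openConn k o ∩ openConn k b = D ∩ openConn k b ∩ openConn k o from by ac_rfl]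
  have h16 := QuantBHK.condCov_openConn_pos_iff w E hE0 hE1 k (↑T : Set (Fin n)) (fun h => hkT (Finset.mem_coe.1 h)) b o
    ⟨hbk, fun h => hbT (Finset.mem_coe.1 h)⟩ ⟨hok, fun h => hoT (Finset.mem_coe.1 h)⟩
  obtain ⟨-, -, hcov0⟩ := surplus_pieces_nonneg w E hE0 hE1 A r hr k hkA o hoA F hF hF0 hcompat
  have hH : covD w k (↑T : Set (Fin n)) (fun C : Set (Sym2 (Fin n)) => F {a | a = k ∨ ∃ e ∈ C, a ∈ e}) o = 0 ↔
      ¬ ((openGraph {f | f ∈ E ∧ k ∉ f ∧ ∀ x ∈ (↑T : Set (Fin n)), x ∉ f}).Reachable b o ∧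
          ∃ u, s(k, u) ∈ E ∧ (openGraph {f | f ∈ E ∧ k ∉ f ∧ ∀ x ∈ (↑T : Set (Fin n)), x ∉ f}).Reachable b u) := by
    rw [← h16]
    simp only [← hμ, ← hD]
    rw [hcov] at hcov0 ⊢
    constructor
    · intro h0 hlt; linarith
    · intro hnlt
      rw [not_lt] at hnlt
      linarith
  rw [← hH, ← hZ]
  constructor
  · intro heq
    have h0 : surplus w A r F o = 0 := by rw [hslack, heq, sub_self]
    exact hiff3.1 h0
  · intro h
    have h0 := hiff3.2 h
    rw [hslack] at h0
    linarith

end CSH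

end Summit.CriticalPhenomena.PercolationContinuityZ3.Theorems

end
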